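import Mathlib.Analysis.Calculus.Deriv.MeanValue
import Mathlib.Topology.MetricSpace.Sequences
import Literature.Geometry.Lorentzian.KerrSchild
import HarnessLib

/-!
# `CaptureSufficesTame` (stmt-FinalStateConjecture-17270), line `only-the-third-law-is-generic`, brick F2
# `stub_noC0_flatGenerators` — helper file: the closed future cone of `ℝ⁴₁`, the cone mean value theorem,
# straight push-up and backward null boundary segments

Elementary facts about the Minkowski form `η = Minkowski.bilin` on `E4` (signature `(−,+,+,+)`, time index `0`) and about
a set `J ⊆ E4` satisfying STRAIGHT PUSH-UP relative to an open set `U` (if `A ∈ closure J`, `v` future timelike and the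
segment `[A, A + v] ⊆ U`, then `A + v ∈ interior J` — clause (i) of brick F1 `stub_noC0_flatBasics` along straight
segments), used by the proof of brick F2 (Penrose's lemma on achronal boundaries for `ℝ⁴₁` relative to a bounded open
set, `PhaseMixingCaptureCaptureSufficesTameNoC0FlatGenerators.lean`):

* `gen_norm_sq` — `‖w‖² = η(w, w) + 2 (w⁰)²`; `gen_bilin_le_zero` — reverse Cauchy–Schwarz in the closed cone;
  `gen_causal_of_forall_bilin_le_zero` — the closed future cone is self-polar;
* `gen_norm_sub_sq_of_null`, `gen_bilin_add_lt_zero_of_null_ne` — two future null vectors with unit time component are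
  `η`-orthogonal iff equal, otherwise every positive combination is timelike; `gen_timelike_add_basisVector`;
* `gen_cone_mvt` — mean value theorem in the closed cone for paths differentiable on `[a, b]` with future causal
  velocities; `gen_causal_of_mem_closure`, `gen_time_lt_of_mem_closure` — `closure J(U, P)` lies in the closed future
  cone of `P`, strictly later than `P` away from `P`;
* `gen_pushup_straight` — clause (i) of F1 gives straight push-up; `gen_mem_closure_of_push`;
* `gen_segment` (registered sub-goal) — a backward null segment `Y − s n`, `0 ≤ s ≤ r`, inside a ball of `U`, whose lower
  end is in `closure J` and whose upper end `Y` is NOT in `interior J`, lies entirely in `U ∩ closure J ∖ interior J`.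

Coordinate computations with `Minkowski.bilin_apply`, `antitoneOn_of_deriv_nonpos`, and limits `ε → 0⁺` of pushed
points. O'Neill 1983, Ch. 5, Lemma 5.26–Prop. 5.30 (timecones of `ℝⁿ₁`) and Ch. 14, Cor. 14.1, Lemma 14.3, Cor. 14.27.
-/

-- the doubled `FinalStateConjecture.FinalStateConjecture` path component trips dupNamespace (as in the skeleton)
set_option linter.dupNamespace false

noncomputable section

open scoped Topology
open Set Filter

namespace Summit.FinalStateConjecture.FinalStateConjecture.Theorems.PhaseMixingCaptureCaptureSufficesTame

open Literature.Geometry.Lorentzian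

/-! ## The quadratic form and the Euclidean norm -/

/-- `‖w‖² = η(w, w) + 2 (w⁰)²` on `E4 = ℝ⁴` with its Euclidean norm (O'Neill 1983, Ch. 5, p. 127: `ℝⁿ₁` is `ℝⁿ` with
the sign of the time axis flipped). [cite: ONeill1983, Ch. 5, Lemma 5.26] -/
theorem gen_norm_sq (w : E4) : ‖w‖ ^ 2 = Minkowski.bilin w w + 2 * (w 0) ^ 2 := by
  rw [EuclideanSpace.real_norm_sq_eq, Fin.sum_univ_succ, Minkowski.bilin_apply]
  simp only [sq]
  ring

/-- A future causal vector is Euclidean-short: `‖w‖² ≤ 2 (w⁰)²` (O'Neill 1983, Ch. 5, Lemma 5.26).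
[cite: ONeill1983, Ch. 5, Lemma 5.26] -/
theorem gen_norm_sq_le_of_causal {w : E4} (hw : Minkowski.bilin w w ≤ 0) : ‖w‖ ^ 2 ≤ 2 * (w 0) ^ 2 := by
  rw [gen_norm_sq]; linarith

/-- A future null vector with unit time component has Euclidean norm at most `3/2` (indeed `√2`).
[cite: ONeill1983, Ch. 5, Lemma 5.26] -/
theorem gen_norm_le_of_null {n : E4} (hn0 : n 0 = 1) (hnn : Minkowski.bilin n n = 0) : ‖n‖ ≤ 3 / 2 := by
  have h : ‖n‖ ^ 2 ≤ (3 / 2) ^ 2 := by rw [gen_norm_sq, hnn, hn0]; norm_num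
  exact (abs_le_of_sq_le_sq' h (by norm_num)).2

/-- A future null vector with unit time component has Euclidean norm at least `1`.
[cite: ONeill1983, Ch. 5, Lemma 5.26] -/
theorem gen_one_le_norm_of_null {n : E4} (hn0 : n 0 = 1) (hnn : Minkowski.bilin n n = 0) : 1 ≤ ‖n‖ := by
  have h : (1 : ℝ) ^ 2 ≤ ‖n‖ ^ 2 := by rw [gen_norm_sq, hnn, hn0]; norm_num
  exact (sq_le_sq₀ zero_le_one (norm_nonneg _)).1 h

/-- A vector with vanishing time component and `η(w, w) ≤ 0` vanishes (the closed cone meets `{w⁰ = 0}` only at `0`;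
O'Neill 1983, Ch. 5, Lemma 5.26). [cite: ONeill1983, Ch. 5, Lemma 5.26] -/
theorem gen_eq_zero_of_causal_of_time_eq_zero {w : E4} (hw : Minkowski.bilin w w ≤ 0) (hw0 : w 0 = 0) : w = 0 := by
  have h : ‖w‖ ^ 2 ≤ 0 := by rw [gen_norm_sq, hw0]; linarith
  have h' : ‖w‖ = 0 := le_antisymm (by nlinarith [norm_nonneg w]) (norm_nonneg w)
  exact norm_eq_zero.1 h'

/-! ## Reverse Cauchy–Schwarz and the closed future cone -/

/-- **Reverse Cauchy–Schwarz in the closed cone**: `η(u, w) ≤ 0` for future causal `u, w` (`η(u,u) ≤ 0 ≤ u⁰`,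
`η(w,w) ≤ 0 ≤ w⁰`). O'Neill 1983, Ch. 5, Prop. 5.30. [cite: ONeill1983, Ch. 5, Prop. 5.30] -/
theorem gen_bilin_le_zero {u w : E4} (hu : Minkowski.bilin u u ≤ 0) (hu0 : 0 ≤ u 0)
    (hw : Minkowski.bilin w w ≤ 0) (hw0 : 0 ≤ w 0) : Minkowski.bilin u w ≤ 0 := by
  simp only [Minkowski.bilin_apply] at hu hw ⊢
  have hcs := Finset.sum_mul_sq_le_sq_mul_sq Finset.univ (fun i : Fin 3 ↦ u i.succ) (fun i ↦ w i.succ)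
  simp only [sq] at hcs
  have hSu : ∑ i : Fin 3, u i.succ * u i.succ ≤ u 0 * u 0 := by linarith
  have hSw : ∑ i : Fin 3, w i.succ * w i.succ ≤ w 0 * w 0 := by linarith
  have hSu0 : 0 ≤ ∑ i : Fin 3, u i.succ * u i.succ := Finset.sum_nonneg fun i _ ↦ mul_self_nonneg _
  have hSw0 : 0 ≤ ∑ i : Fin 3, w i.succ * w i.succ := Finset.sum_nonneg fun i _ ↦ mul_self_nonneg _
  have h1 : (∑ i : Fin 3, u i.succ * w i.succ) * ∑ i : Fin 3, u i.succ * w i.succ ≤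
      (u 0 * w 0) * (u 0 * w 0) :=
    calc (∑ i : Fin 3, u i.succ * w i.succ) * ∑ i : Fin 3, u i.succ * w i.succ
        ≤ (∑ i : Fin 3, u i.succ * u i.succ) * ∑ i : Fin 3, w i.succ * w i.succ := hcs
      _ ≤ (u 0 * u 0) * (w 0 * w 0) := mul_le_mul hSu hSw hSw0 (hSu0.trans hSu)
      _ = (u 0 * w 0) * (u 0 * w 0) := by ring
  have h2 : ∑ i : Fin 3, u i.succ * w i.succ ≤ u 0 * w 0 :=
    (abs_le_of_sq_le_sq' (by simpa only [sq] using h1) (mul_nonneg hu0 hw0)).2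
  linarith

/-- `η(∂ₜ, ∂ₜ) ≤ 0 ≤ (∂ₜ)⁰`: the time axis is future causal (O'Neill 1983, Ch. 3, p. 55). [cite: ONeill1983, Ch. 3, p. 55] -/
theorem gen_basisVector_causal :
    Minkowski.bilin (E4.basisVector 0) (E4.basisVector 0) ≤ 0 ∧ (0 : ℝ) ≤ (E4.basisVector 0 : E4) 0 := by
  rw [Minkowski.bilin_basisVector_zero]
  norm_num

/-- **The closed future cone is self-polar**: if `η(u, w) ≤ 0` for every future causal `u`, then `w` is future causal.
(Test with `u = ∂ₜ` for `w⁰ ≥ 0`, and with the null vector `u = w + (|w⃗| − w⁰) ∂ₜ` for `η(w, w) ≤ 0`.) O'Neill 1983,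
Ch. 5, Lemma 5.29–Prop. 5.30. [cite: ONeill1983, Ch. 5, Prop. 5.30] -/
theorem gen_causal_of_forall_bilin_le_zero {w : E4}
    (h : ∀ u : E4, Minkowski.bilin u u ≤ 0 → 0 ≤ u 0 → Minkowski.bilin u w ≤ 0) :
    Minkowski.bilin w w ≤ 0 ∧ 0 ≤ w 0 := by
  have hw0 : 0 ≤ w 0 := by
    have := h (E4.basisVector 0) gen_basisVector_causal.1 gen_basisVector_causal.2
    rw [Minkowski.bilin_basisVector_zero_left] at this
    linarith
  refine ⟨?_, hw0⟩
  -- the spatial norm `ρ = |w⃗|` and the null test vector `u = w + (ρ - w⁰) ∂ₜ`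
  set S : ℝ := ∑ i : Fin 3, w i.succ * w i.succ with hS
  have hS0 : 0 ≤ S := Finset.sum_nonneg fun i _ ↦ mul_self_nonneg _
  set ρ : ℝ := Real.sqrt S with hρ
  have hρ0 : 0 ≤ ρ := Real.sqrt_nonneg _
  have hρS : ρ * ρ = S := Real.mul_self_sqrt hS0
  set u : E4 := w + (ρ - w 0) • E4.basisVector 0 with hu
  have hu0 : u 0 = ρ := by simp [hu]
  have hui : ∀ i : Fin 3, u i.succ = w i.succ := fun i ↦ by simp [hu, Fin.succ_ne_zero]
  have huu : Minkowski.bilin u u = 0 := by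
    rw [Minkowski.bilin_apply, hu0]
    simp only [hui]
    linarith
  have huw : Minkowski.bilin u w = -(ρ * w 0) + S := by
    rw [Minkowski.bilin_apply, hu0]
    simp only [hui, hS]
  have key := h u huu.le (hu0 ▸ hρ0)
  rw [huw] at key
  rw [Minkowski.bilin_apply, ← hS]
  nlinarith [sq_nonneg (w 0 - ρ)]

/-! ## Null vectors with unit time component -/

/-- For future null `n, m` with `n⁰ = m⁰ = 1`: `‖n − m‖² = −2 η(n, m)`; in particular `η(n, m) ≤ 0` with equality iff
`n = m` (O'Neill 1983, Ch. 5, Cor. 5.30 ff.). [cite: ONeill1983, Ch. 5, Prop. 5.30] -/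
theorem gen_norm_sub_sq_of_null {n m : E4} (hn0 : n 0 = 1) (hnn : Minkowski.bilin n n = 0) (hm0 : m 0 = 1)
    (hmm : Minkowski.bilin m m = 0) : ‖n - m‖ ^ 2 = -2 * Minkowski.bilin n m := by
  rw [gen_norm_sq]
  simp only [Minkowski.bilin_apply, PiLp.sub_apply, hn0, hm0] at hnn hmm ⊢
  rw [Fin.sum_univ_three] at hnn hmm ⊢
  rw [Fin.sum_univ_three]
  nlinarith [hnn, hmm]

/-- For future null `n ≠ m` with unit time components and `δ, s > 0`, the combination `δ n + s m` is future TIMELIKE: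
`η(δ n + s m, δ n + s m) = 2 δ s η(n, m) = −δ s ‖n − m‖² < 0` (two non-parallel null vectors span a timelike plane;
O'Neill 1983, Ch. 5, Lemma 5.26 ff.). [cite: ONeill1983, Ch. 5, Lemma 5.26] -/
theorem gen_bilin_add_lt_zero_of_null_ne {n m : E4} (hn0 : n 0 = 1) (hnn : Minkowski.bilin n n = 0) (hm0 : m 0 = 1)
    (hmm : Minkowski.bilin m m = 0) (hne : n ≠ m) {δ s : ℝ} (hδ : 0 < δ) (hs : 0 < s) :
    Minkowski.bilin (δ • n + s • m) (δ • n + s • m) < 0 ∧ 0 < (δ • n + s • m) 0 := by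
  have hpos : 0 < ‖n - m‖ ^ 2 := by
    have : 0 < ‖n - m‖ := norm_pos_iff.2 (sub_ne_zero.2 hne)
    positivity
  have hkey := gen_norm_sub_sq_of_null hn0 hnn hm0 hmm
  refine ⟨?_, by simp [hn0, hm0]; positivity⟩
  have hexp : Minkowski.bilin (δ • n + s • m) (δ • n + s • m) =
      δ * δ * Minkowski.bilin n n + 2 * (δ * s) * Minkowski.bilin n m + s * s * Minkowski.bilin m m := by
    simp only [Minkowski.bilin_apply, PiLp.add_apply, PiLp.smul_apply, smul_eq_mul, Fin.sum_univ_three]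
    ring
  rw [hexp, hnn, hmm]
  nlinarith [mul_pos hδ hs]

/-- Pushing a future causal vector up the time axis gives a future timelike vector:
`η(v + ε ∂ₜ, v + ε ∂ₜ) = η(v, v) − 2 ε v⁰ − ε² < 0` for `ε > 0` (O'Neill 1983, Ch. 5, Lemma 5.26).
[cite: ONeill1983, Ch. 5, Lemma 5.26] -/
theorem gen_timelike_add_basisVector {v : E4} (hv : Minkowski.bilin v v ≤ 0) (hv0 : 0 ≤ v 0) {ε : ℝ} (hε : 0 < ε) :
    Minkowski.bilin (v + ε • E4.basisVector 0) (v + ε • E4.basisVector 0) < 0 ∧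
      0 < (v + ε • E4.basisVector 0) 0 := by
  refine ⟨?_, by simp; linarith⟩
  have hexp : Minkowski.bilin (v + ε • E4.basisVector 0) (v + ε • E4.basisVector 0) =
      Minkowski.bilin v v - 2 * ε * v 0 - ε * ε := by
    simp only [Minkowski.bilin_apply, PiLp.add_apply, PiLp.smul_apply, smul_eq_mul, Fin.sum_univ_three,
      PiLp.single_apply]
    simp
    ring
  rw [hexp]
  nlinarith

/-! ## The mean value theorem in the closed cone -/

/-- **Cone mean value theorem.** If `γ : ℝ → E4` has a future causal velocity (`η(v, v) ≤ 0 < v⁰`) at every point of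
`[a, b]`, `a ≤ b`, then the displacement `γ b − γ a` is future causal. (For each future causal `u` the function
`t ↦ η(u, γ t)` has derivative `η(u, v) ≤ 0` by reverse Cauchy–Schwarz, hence is non-increasing; conclude by
self-polarity of the closed cone.) O'Neill 1983, Ch. 5, Prop. 5.30 and Ch. 14, Lemma 14.3 (flat case).
[cite: ONeill1983, Ch. 14, Lemma 14.3] -/
theorem gen_cone_mvt {γ : ℝ → E4} {a b : ℝ} (hab : a ≤ b)
    (hγ : ∀ t ∈ Icc a b, ∃ v : E4, HasDerivAt γ v t ∧ Minkowski.bilin v v ≤ 0 ∧ 0 < v 0) :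
    Minkowski.bilin (γ b - γ a) (γ b - γ a) ≤ 0 ∧ 0 ≤ (γ b - γ a) 0 := by
  apply gen_causal_of_forall_bilin_le_zero
  intro u hu hu0
  have hcont : ContinuousOn (fun t ↦ Minkowski.bilin u (γ t)) (Icc a b) := by
    intro t ht
    obtain ⟨v, hv, -, -⟩ := hγ t ht
    exact ((Minkowski.bilin u).continuous.continuousAt.comp hv.continuousAt).continuousWithinAt
  have hanti : AntitoneOn (fun t ↦ Minkowski.bilin u (γ t)) (Icc a b) := by
    refine antitoneOn_of_deriv_nonpos (convex_Icc a b) hcont ?_ ?_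
    · intro t ht
      rw [interior_Icc] at ht
      obtain ⟨v, hv, -, -⟩ := hγ t (Ioo_subset_Icc_self ht)
      have h' : HasDerivAt (fun t ↦ Minkowski.bilin u (γ t)) (Minkowski.bilin u v) t :=
        (Minkowski.bilin u).hasFDerivAt.comp_hasDerivAt t hv
      exact h'.differentiableAt.differentiableWithinAt
    · intro t ht
      rw [interior_Icc] at ht
      obtain ⟨v, hv, hvv, hv0⟩ := hγ t (Ioo_subset_Icc_self ht)
      have h' : HasDerivAt (fun t ↦ Minkowski.bilin u (γ t)) (Minkowski.bilin u v) t :=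
        (Minkowski.bilin u).hasFDerivAt.comp_hasDerivAt t hv
      rw [h'.deriv]
      exact gen_bilin_le_zero hu hu0 hvv hv0.le
  have h := hanti (left_mem_Icc.2 hab) (right_mem_Icc.2 hab) hab
  simp only at h
  rw [map_sub]
  linarith

/-! ## The closure of the relative causal future lies in the closed cone of the vertex -/

/-- If every point of `J` other than `P` is the endpoint of a path from `P` with future causal velocities (as for the
relative causal future `J(U, P)`), then every `Y ∈ closure J` has `Y − P` future causal: `η(Y − P, Y − P) ≤ 0` and
`P⁰ ≤ Y⁰` (cone mean value theorem + closedness of the cone). O'Neill 1983, Ch. 14, Lemma 14.3 (flat case).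
[cite: ONeill1983, Ch. 14, Lemma 14.3] -/
theorem gen_causal_of_mem_closure {J : Set E4} {P : E4}
    (hJ : ∀ Y ∈ J, Y = P ∨ ∃ (γ : ℝ → E4) (a b : ℝ), a < b ∧ γ a = P ∧ γ b = Y ∧
      ∀ t ∈ Icc a b, ∃ v : E4, HasDerivAt γ v t ∧ Minkowski.bilin v v ≤ 0 ∧ 0 < v 0)
    {Y : E4} (hY : Y ∈ closure J) :
    Minkowski.bilin (Y - P) (Y - P) ≤ 0 ∧ P 0 ≤ Y 0 := by
  have hf : Continuous fun Z : E4 ↦ Minkowski.bilin (Z - P) (Z - P) := by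
    simp only [Minkowski.bilin_apply]
    fun_prop
  have hg : Continuous fun Z : E4 ↦ Z 0 := by fun_prop
  have hclosed : IsClosed {Z : E4 | Minkowski.bilin (Z - P) (Z - P) ≤ 0 ∧ P 0 ≤ Z 0} := by
    rw [setOf_and]
    exact (isClosed_le hf continuous_const).inter (isClosed_le continuous_const hg)
  have hsub : J ⊆ {Z : E4 | Minkowski.bilin (Z - P) (Z - P) ≤ 0 ∧ P 0 ≤ Z 0} := by
    intro Z hZ
    rcases hJ Z hZ with rfl | ⟨γ, a, b, hab, hγa, hγb, hγ⟩
    · simp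
    · have h := gen_cone_mvt hab.le hγ
      rw [hγa, hγb] at h
      refine ⟨h.1, ?_⟩
      have h2 := h.2
      simp only [PiLp.sub_apply, sub_nonneg] at h2
      exact h2
  exact closure_minimal hsub hclosed hY

/-- In the situation of `gen_causal_of_mem_closure`, a point `Y ≠ P` of `closure J` is STRICTLY later than `P`:
`P⁰ < Y⁰` (a future causal vector with vanishing time component vanishes). O'Neill 1983, Ch. 14, Lemma 14.3.
[cite: ONeill1983, Ch. 14, Lemma 14.3] -/
theorem gen_time_lt_of_mem_closure {J : Set E4} {P : E4}
    (hJ : ∀ Y ∈ J, Y = P ∨ ∃ (γ : ℝ → E4) (a b : ℝ), a < b ∧ γ a = P ∧ γ b = Y ∧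
      ∀ t ∈ Icc a b, ∃ v : E4, HasDerivAt γ v t ∧ Minkowski.bilin v v ≤ 0 ∧ 0 < v 0)
    {Y : E4} (hY : Y ∈ closure J) (hYP : Y ≠ P) : P 0 < Y 0 := by
  obtain ⟨hc, ht⟩ := gen_causal_of_mem_closure hJ hY
  refine lt_of_le_of_ne ht fun heq ↦ hYP ?_
  have h0 : (Y - P) 0 = 0 := by simp [heq]
  exact sub_eq_zero.1 (gen_eq_zero_of_causal_of_time_eq_zero hc h0)

/-! ## Push-up along straight timelike segments; limits of pushed points -/

/-- Straight-segment form of the PUSH-UP hypothesis (i) of brick F1: if `A ∈ closure J`, `v` is future timelike and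
the segment `A + t v`, `t ∈ [0, 1]`, lies in `U`, then `A + v ∈ interior J` (the segment is a flat timelike path).
O'Neill 1983, Ch. 14, Cor. 14.1. [cite: ONeill1983, Ch. 14, Cor. 14.1] -/
theorem gen_pushup_straight {U J : Set E4}
    (hi : ∀ A B : E4, A ∈ U → B ∈ U → A ∈ closure J →
      (∃ (γ : ℝ → E4) (a b : ℝ), a < b ∧ γ a = A ∧ γ b = B ∧
        ∀ t ∈ Icc a b, γ t ∈ U ∧ ∃ v : E4, HasDerivAt γ v t ∧ Minkowski.bilin v v < 0 ∧ 0 < v 0) →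
      B ∈ interior J)
    {A v : E4} (hA : A ∈ closure J) (hvv : Minkowski.bilin v v < 0) (hv0 : 0 < v 0)
    (hseg : ∀ t ∈ Icc (0 : ℝ) 1, A + t • v ∈ U) : A + v ∈ interior J := by
  have hA0 : A ∈ U := by simpa using hseg 0 ⟨le_rfl, zero_le_one⟩
  have hA1 : A + v ∈ U := by simpa using hseg 1 ⟨zero_le_one, le_rfl⟩
  refine hi A (A + v) hA0 hA1 hA
    ⟨fun t ↦ A + t • v, 0, 1, zero_lt_one, by simp, by simp, fun t ht ↦ ⟨hseg t ht, v, ?_, hvv, hv0⟩⟩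
  have h := ((hasDerivAt_id t).smul_const v).const_add A
  simpa using h

/-- A point `M` whose upward time-translates `M + ε ∂ₜ`, `0 < ε < ε₀`, all lie in `interior J` lies in `closure J`
(let `ε → 0⁺`). [folklore] -/
theorem gen_mem_closure_of_push {J : Set E4} {M : E4} {ε₀ : ℝ} (hε₀ : 0 < ε₀)
    (h : ∀ ε : ℝ, 0 < ε → ε < ε₀ → M + ε • E4.basisVector 0 ∈ interior J) : M ∈ closure J := by
  have ht : Tendsto (fun ε : ℝ ↦ M + ε • E4.basisVector 0) (𝓝[>] 0) (𝓝 M) := by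
    have hc : Continuous fun ε : ℝ ↦ M + ε • E4.basisVector 0 := by fun_prop
    have := hc.tendsto 0
    simp only [zero_smul, add_zero] at this
    exact this.mono_left nhdsWithin_le_nhds
  refine isClosed_closure.mem_of_tendsto ht ?_
  filter_upwards [Ioo_mem_nhdsGT hε₀] with ε hε
    using interior_subset.trans subset_closure (h ε hε.1 hε.2)

/-- `‖a n + b ∂ₜ‖ ≤ |a| ‖n‖ + |b|` in `E4`. [folklore] -/
theorem gen_norm_smul_add_smul_le (n : E4) (a b : ℝ) :
    ‖a • n + b • E4.basisVector 0‖ ≤ |a| * ‖n‖ + |b| := by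
  have hb : ‖(E4.basisVector 0 : E4)‖ = 1 := by simp
  calc ‖a • n + b • E4.basisVector 0‖ ≤ ‖a • n‖ + ‖b • E4.basisVector 0‖ := norm_add_le _ _
    _ = |a| * ‖n‖ + |b| := by rw [norm_smul, norm_smul, hb, Real.norm_eq_abs, Real.norm_eq_abs, mul_one]

/-! ## A backward null segment with lower end in `closure J` and upper end off `interior J` is boundary -/

/-- **Segment lemma.** Let `J ⊆ E4` satisfy straight push-up relative to `U`, let `Y ∉ interior J`, `n` future null with
`n⁰ = 1`, `r > 0` with `ball(Y, 2r) ⊆ U`, and `Y − r n ∈ closure J`. Then the whole backward null segment `Y − s n`,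
`s ∈ [0, r]`, lies in `U ∩ closure J ∖ interior J`: each point pushed up by `ε ∂ₜ` is in `interior J` (push-up from
`Y − r n`), and were a point interior, pushing up from slightly below it would put `Y` in `interior J`. This is the flat
relative form of "`J⁺ ∘ I⁺ ⊆ I⁺` and achronal boundaries". O'Neill 1983, Ch. 14, Cor. 14.1 and Cor. 14.27.
[cite: ONeill1983, Ch. 14, Cor. 14.27] -/
theorem gen_segment :
    ∀ (U J : Set E4), (∀ A ∈ closure J, ∀ v : E4, Minkowski.bilin v v < 0 → 0 < v 0 →
      (∀ t ∈ Set.Icc (0 : ℝ) 1, A + t • v ∈ U) → A + v ∈ interior J) →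
    ∀ (Y n : E4) (r : ℝ), Y ∉ interior J → n 0 = 1 → Minkowski.bilin n n = 0 → 0 < r →
      Metric.ball Y (2 * r) ⊆ U → Y - r • n ∈ closure J →
      ∀ s ∈ Set.Icc 0 r, Y - s • n ∈ U ∧ Y - s • n ∈ closure J ∧ Y - s • n ∉ interior J := by
  intro U J hpush Y n r hYint hn0 hnn hr hball hZ
  have hn := gen_norm_le_of_null hn0 hnn
  -- points `Y + a n + b ∂ₜ` with `|a| ≤ r`, `|b| < r / 2` are in the ball, hence in `U`
  have hin : ∀ a b : ℝ, |a| ≤ r → |b| < r / 2 → Y + a • n + b • E4.basisVector 0 ∈ U := by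
    intro a b ha hb
    apply hball
    rw [mem_ball_iff_norm, add_assoc, add_sub_cancel_left]
    have h1 := gen_norm_smul_add_smul_le n a b
    have h2 : |a| * ‖n‖ ≤ r * (3 / 2) := mul_le_mul ha hn (norm_nonneg _) hr.le
    linarith
  have hnull : ∀ c : ℝ, 0 ≤ c → Minkowski.bilin (c • n) (c • n) ≤ 0 ∧ 0 ≤ (c • n) 0 := by
    intro c hc
    refine ⟨le_of_eq ?_, by simp [hn0, hc]⟩
    simp only [Minkowski.bilin_apply, PiLp.smul_apply, smul_eq_mul, Fin.sum_univ_three] at hnn ⊢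
    linear_combination (c * c) * hnn
  intro s hs
  obtain ⟨hs0, hsr⟩ := hs
  refine ⟨?_, ?_, ?_⟩
  · have := hin (-s) 0 (by rw [abs_neg, abs_of_nonneg hs0]; exact hsr) (by simpa using half_pos hr)
    simpa [sub_eq_add_neg, neg_smul] using this
  · refine gen_mem_closure_of_push (half_pos hr) fun ε hε hεr ↦ ?_
    have hv := gen_timelike_add_basisVector (hnull (r - s) (sub_nonneg.2 hsr)).1 (hnull (r - s) (sub_nonneg.2 hsr)).2 hε
    have key := hpush (Y - r • n) hZ ((r - s) • n + ε • E4.basisVector 0) hv.1 hv.2 ?_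
    · convert key using 1
      module
    · intro t ht
      have h := hin (-r + t * (r - s)) (t * ε) (abs_le.2 ⟨by nlinarith [ht.1], by nlinarith [ht.2]⟩)
        (by rw [abs_of_nonneg (by nlinarith [ht.1])]; nlinarith [ht.2])
      convert h using 1
      module
  · intro hM
    obtain ⟨ε₁, hε₁, hballM⟩ := Metric.isOpen_iff.1 isOpen_interior _ hM
    obtain ⟨ε, hε, hεε₁, hεr⟩ : ∃ ε : ℝ, 0 < ε ∧ ε < ε₁ ∧ ε < r / 2 :=
      ⟨min (ε₁ / 2) (r / 4), lt_min (half_pos hε₁) (by linarith),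
        (min_le_left _ _).trans_lt (half_lt_self hε₁), (min_le_right _ _).trans_lt (by linarith)⟩
    have hA : Y - s • n - ε • E4.basisVector 0 ∈ closure J := by
      refine interior_subset.trans subset_closure (hballM ?_)
      have hb : ‖(E4.basisVector 0 : E4)‖ = 1 := by simp
      rw [mem_ball_iff_norm, sub_sub_cancel_left, norm_neg, norm_smul, hb, Real.norm_eq_abs, abs_of_pos hε, mul_one]
      exact hεε₁
    have hv := gen_timelike_add_basisVector (hnull s hs0).1 (hnull s hs0).2 hε
    have key := hpush _ hA (s • n + ε • E4.basisVector 0) hv.1 hv.2 ?_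
    · apply hYint
      convert key using 1
      module
    · intro t ht
      have h := hin (-((1 - t) * s)) (-((1 - t) * ε))
        (by rw [abs_neg, abs_of_nonneg (by nlinarith [ht.2])]; nlinarith [ht.1])
        (by rw [abs_neg, abs_of_nonneg (by nlinarith [ht.2])]; nlinarith [ht.1])
      convert h using 1
      module

end Summit.FinalStateConjecture.FinalStateConjecture.Theorems.PhaseMixingCaptureCaptureSufficesTame

end
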